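import Summits.BirchSwinnertonDyer.BirchSwinnertonDyer.Theorems.SignedLowerHalvesSmallImageLowerHalfBothSignsRttD2SeqSemilocLayerPairing
import Summits.BirchSwinnertonDyer.BirchSwinnertonDyer.Theorems.SignedLowerHalvesSmallImageLowerHalfBothSignsRttD2SeqJ3HControl
import HarnessLib

/-!
# Route `SignedLowerHalves`, crux L `SmallImageLowerHalfBothSigns` (stmt-BirchSwinnertonDyer-23599), line `rtt_w3` v30 — stub S3β″ (`stub_junctionPT_ns`, row J4′,
# Poitou–Tate half), brick N2d-A: THE A-SIDE LOCALISATION DICTIONARY AT A DEPLETED PLACE `w` AND THE MACKEY VANISHING OF THE SEMILOCAL DUAL CLASS —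
# `semilocDual_{w,n,k} ℓ = 0` as soon as EVERY conjugate `conj_δ ℓ` of the torsion-level layer class `ℓ ∈ H¹(U_n, M[p^k])` is locally trivial at `w`

WIDTH seat `bsd-line-slh-p3-w3` g26 under LEAD `cruxlead-stmt-BirchSwinnertonDyer-23599` g14 (cell `bsd-ssimc`); helper `--supports stmt-BirchSwinnertonDyer-23599`
(design memo `Lines/rtt_w3-DESIGN-S3beta-w3-g25.md`, rev 4 §6 RECIPE N2d (α)). PURE THEOREMS; no definition, no named fact, no instance, no `sorry`.
HONEST FRAMING: bookkeeping for the vanishing of the semilocal tower pairing `Φ` on the strict Selmer group (brick N2d of S3β″) and for α5′ (e) of S3α′ (LEAD g14 add. 30: local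
triviality over `K_∞` at the finitely many `Σ`-places descends to a finite stage); nothing about S3β″, S3α′, crux L or BSD is proved; all remain OPEN and are proved for NO curve.

WHAT.
* §1 generic commutations on `H¹(U, M[p^k])` (any topological group): `torsIncl_resOfLe`, `torsIncl_conjH1'` (raising the torsion level commutes with restriction and conjugation).
* §2 at a place `w` with a local action pinned by `hres` (g22's `locH1Layer`/`locH1` dialect, ANY coefficient module): `locH1Layer_resOfLe` (localisation commutes with the layer
  restrictions `U_m ≤ U_n`), `locH1_resOfLe` (pointwise form of `resOfLe_comp_locH1Layer`), `locH1Layer_torsToH1`/`locH1Layer_torsIncl` (with the coefficient maps `M[p^k] ⊆ M`,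
  `M[p^k] ⊆ M[p^{k′}]`), `locH1_conjH1_of_mem` (inner classes).
* §3 ★★ `semilocDual_eq_zero_of_forall_locH1Layer_conjH1_eq_zero`: for the canonical local action at `w` (`localAction`, pin `rfl`), if `loc_{n,w}(conj_δ ℓ) = 0` in
  `H¹(U_{n,w}, M[p^k])` for every `δ ∈ Γ_K`, then `semilocDual … w n k ℓ = 0` — the tree's semilocal vanishing criterion `map_restrict_eq_zero_iff_forall_conjMap_one` (Mackey–Shapiro,
  NSW (1.6.4)–(1.6.5)) on the A-side for `Sh_{U_n} ℓ`, read through `sh ∘ Sh = id` and the naturality of `loc_w` in the duality morphism `Ψ`; hence ★ `semilocPairNKQ_eq_zero_of_forall…`.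
References: [NeukirchSchmidtWingberg2008] I §5 (1.5.6)–(1.5.7), I §6 (1.6.4)–(1.6.5), (8.6.2); [SerreLocalFields1979] VII §5; [SerreGaloisCohomology1997] I §2.4–2.5; [Rubin2000] App. B.2–B.3.
-/

set_option autoImplicit false
set_option linter.dupNamespace false -- D-0017: single-problem summit, the namespace repeats the problem name by design
noncomputable section

open scoped Classical
open CategoryTheory Function NumberField IsDedekindDomain Field

namespace Summit.BirchSwinnertonDyer.BirchSwinnertonDyer.Theorems.SmallImageRttD2Seq

open Literature.NumberTheory.GaloisRepresentations Literature.NumberTheory.GaloisCohomology Literature.NumberTheory.EllipticCurves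
  Literature.NumberTheory.ComplexMultiplication.EllipticUnits Literature.NumberTheory.ComplexMultiplication.EllipticUnits.JohnsonLeungKings2011
  Literature.NumberTheory.GaloisRepresentations.DiscreteGaloisModule Literature.NumberTheory.GaloisCohomology.PoitouTateFinite
  Literature.AnabelianGeometry.AbsoluteAnabelian.Prop121vii
  Summit.BirchSwinnertonDyer.BirchSwinnertonDyer.Theorems.SmallImageRttD2J1 Summit.BirchSwinnertonDyer.BirchSwinnertonDyer.Theorems.SmallImageCharSignedSelmer

/-! ## §1. Raising the torsion level commutes with restriction and conjugation -/

section Generic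

variable {G : Type} [Group G] [TopologicalSpace G] [IsTopologicalGroup G]
  (N : Type) [AddCommGroup N] [DistribMulAction G N] [TopologicalSpace N] [DiscreteTopology N] (q : ℕ)

/-- `torsIncl ∘ resOfLe = resOfLe ∘ torsIncl` (both are the map of the pair `(U′ ↪ U, M[p^k] ⊆ M[p^{k′}])`). [cite: SerreGaloisCohomology1997, I §2.4] -/
theorem torsIncl_resOfLe {U U' : Subgroup G} (hU : U' ≤ U) {k k' : ℕ} (h : k ≤ k') (ℓ : subgroupH1 U ↥(torsionPow N q k)) :
    torsIncl N q U' h (resOfLe ↥(torsionPow N q k) hU ℓ) = resOfLe ↥(torsionPow N q k') hU (torsIncl N q U h ℓ) := by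
  rw [← AddMonoidHom.comp_apply, ← AddMonoidHom.comp_apply, torsIncl, torsIncl, resOfLe, resOfLe, resH1Hom_comp, resH1Hom_comp]
  exact DFunLike.congr_fun (resH1Hom_congr (by ext; rfl) (by ext; rfl) _ _) ℓ

/-- `torsIncl ∘ conj_σ = conj_σ ∘ torsIncl` (`U` normal; both are the map of the pair `(σ⁻¹·σ, σ • incl)`). [cite: SerreGaloisCohomology1997, I §2.5] -/
theorem torsIncl_conjH1' (U : Subgroup G) [U.Normal] (σ : G) {k k' : ℕ} (h : k ≤ k') (ℓ : subgroupH1 U ↥(torsionPow N q k)) :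
    torsIncl N q U h (conjH1 U ↥(torsionPow N q k) σ ℓ) = conjH1 U ↥(torsionPow N q k') σ (torsIncl N q U h ℓ) := by
  rw [← AddMonoidHom.comp_apply, ← AddMonoidHom.comp_apply, torsIncl, conjH1, conjH1, resH1Hom_comp, resH1Hom_comp]
  exact DFunLike.congr_fun (resH1Hom_congr (by ext; rfl) (by ext; rfl) _ _) ℓ

/-- Inner classes act trivially: `conj_δ ℓ = conj_σ ℓ` on `H¹(U, ·)` when `σ⁻¹ δ ∈ U`. [cite: SerreLocalFields1979, VII §5 Prop. 3] -/
theorem conjH1_eq_conjH1_of_inv_mul_mem (U : Subgroup G) [U.Normal] {σ δ : G} (h : σ⁻¹ * δ ∈ U) (ℓ : subgroupH1 U N) :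
    conjH1 U N δ ℓ = conjH1 U N σ ℓ := by
  conv_lhs => rw [← mul_inv_cancel_left σ δ, conjH1_mul_holds U N, AddMonoidHom.comp_apply, conjH1_of_mem_holds U N h, AddMonoidHom.id_apply]

end Generic

/-! ## §2. Localisation at a place `w` versus the layer maps, the torsion levels and conjugation -/

section Place

variable {K : Type} [Field K] [NumberField K] {p : ℕ} [Fact p.Prime] (κ : ZpExtension K p) (w : HeightOneSpectrum (𝓞 K))
  (N : Type) [AddCommGroup N] [TopologicalSpace N] [DiscreteTopology N] [DistribMulAction (absoluteGaloisGroup K) N]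
  [DistribMulAction (absoluteGaloisGroup (w.adicCompletion K)) N]
  (hres : ∀ (σ : absoluteGaloisGroup (w.adicCompletion K)) (m : N), σ • m = resGalOfEmb (closureEmb (K := K) (w.adicCompletion K)) σ • m)

/-- **`loc_{w,m} ∘ res_{U_m ≤ U_n} = res^{loc}_{n→m} ∘ loc_{w,n}`** (pointwise form of g24's `resOfLe_comp_locH1Layer_layer`, p805395-lineage). [cite: SerreGaloisCohomology1997, I §2.4] -/
theorem locH1Layer_resOfLe {n m : ℕ} (hnm : n ≤ m) (c : subgroupH1 (κ.layerSubgroup n) N) :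
    locH1Layer κ N w hres m (resOfLe N (κ.layerSubgroup_antitone hnm) c) =
      resOfLe N (localSubgroupOfEmb_layerSubgroup_antitone κ w hnm) (locH1Layer κ N w hres n c) :=
  (DFunLike.congr_fun (resOfLe_comp_locH1Layer_layer κ w N hres hnm) c).symm

/-- **`loc_w ∘ res_{n→∞} = res^{loc}_{n→∞} ∘ loc_{w,n}`** (pointwise `resOfLe_comp_locH1Layer`). [cite: SerreGaloisCohomology1997, I §2.5] -/
theorem locH1_resOfLe (n : ℕ) (c : subgroupH1 (κ.layerSubgroup n) N) :
    locH1 κ N w hres (resOfLe N (κ.kerSubgroup_le_layerSubgroup n) c) = resOfLe N (localSubgroupOfEmb_kerSubgroup_le κ w n) (locH1Layer κ N w hres n c) := by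
  have h := DFunLike.congr_fun (resOfLe_comp_locH1Layer κ N w hres n) c
  rw [AddMonoidHom.comp_apply, AddMonoidHom.comp_apply] at h
  exact h.symm

variable (M : Type) [AddCommGroup M] [TopologicalSpace M] [DiscreteTopology M] [DistribMulAction (absoluteGaloisGroup K) M]
  [DistribMulAction (absoluteGaloisGroup (w.adicCompletion K)) M]
  (hresM : ∀ (σ : absoluteGaloisGroup (w.adicCompletion K)) (m : M), σ • m = resGalOfEmb (closureEmb (K := K) (w.adicCompletion K)) σ • m)

/-- **`loc_{w,n} ∘ torsToH1 = torsToH1 ∘ loc_{w,n}`** on `H¹(U_n, M[p^k])` (both are the map of the pair `(res_w, M[p^k] ⊆ M)`). [cite: SerreGaloisCohomology1997, I §2.4] -/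
theorem locH1Layer_torsToH1 (hresT : ∀ (k : ℕ) (σ : absoluteGaloisGroup (w.adicCompletion K)) (m : ↥(torsionPow M p k)),
      σ • m = resGalOfEmb (closureEmb (K := K) (w.adicCompletion K)) σ • m)
    (n k : ℕ) (ℓ : subgroupH1 (κ.layerSubgroup n) ↥(torsionPow M p k)) :
    locH1Layer κ M w hresM n (torsToH1 M p (κ.layerSubgroup n) k ℓ) =
      torsToH1 M p (localSubgroupOfEmb (κ.layerSubgroup n) (closureEmb (K := K) (w.adicCompletion K))) k (locH1Layer κ ↥(torsionPow M p k) w (hresT k) n ℓ) := by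
  rw [← AddMonoidHom.comp_apply, ← AddMonoidHom.comp_apply, locH1Layer, locH1Layer, torsToH1, torsToH1, resH1Hom_comp, resH1Hom_comp]
  exact DFunLike.congr_fun (resH1Hom_congr (ContinuousMonoidHom.ext fun _ ↦ rfl) (AddMonoidHom.ext fun _ ↦ rfl) _ _) ℓ

/-- **`loc_{w,n} ∘ torsIncl = torsIncl ∘ loc_{w,n}`** on `H¹(U_n, M[p^k])`. [cite: SerreGaloisCohomology1997, I §2.4] -/
theorem locH1Layer_torsIncl (hresT : ∀ (k : ℕ) (σ : absoluteGaloisGroup (w.adicCompletion K)) (m : ↥(torsionPow M p k)),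
      σ • m = resGalOfEmb (closureEmb (K := K) (w.adicCompletion K)) σ • m)
    (n : ℕ) {k k' : ℕ} (h : k ≤ k') (ℓ : subgroupH1 (κ.layerSubgroup n) ↥(torsionPow M p k)) :
    locH1Layer κ ↥(torsionPow M p k') w (hresT k') n (torsIncl M p (κ.layerSubgroup n) h ℓ) =
      torsIncl M p (localSubgroupOfEmb (κ.layerSubgroup n) (closureEmb (K := K) (w.adicCompletion K))) h (locH1Layer κ ↥(torsionPow M p k) w (hresT k) n ℓ) := by
  rw [← AddMonoidHom.comp_apply, ← AddMonoidHom.comp_apply, locH1Layer, locH1Layer, torsIncl, torsIncl, resH1Hom_comp, resH1Hom_comp]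
  exact DFunLike.congr_fun (resH1Hom_congr (ContinuousMonoidHom.ext fun _ ↦ rfl) (AddMonoidHom.ext fun _ ↦ rfl) _ _) ℓ

end Place

/-! ## §3. Mackey: the semilocal dual class of `ℓ` vanishes when every conjugate of `ℓ` is locally trivial at `w` -/

section Mackey

variable {K : Type} [Field K] [NumberField K] {p : ℕ} [Fact p.Prime] (S : Set (PadicAlgCl p)) [FiniteDimensional ℚ_[p] (padicCoeffField S)] (κ : ZpExtension K p)
  (θ' : absoluteGaloisGroup K →ₜ* (padicCoeffIntegers S)ˣ) (P : Set (HeightOneSpectrum (𝓞 K)))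
  (M : Type) [AddCommGroup M] [TopologicalSpace M] [DiscreteTopology M] [DistribMulAction (absoluteGaloisGroup K) M]
  (hstabK : ∀ m : M, IsOpen (MulAction.stabilizer (absoluteGaloisGroup K) m : Set (absoluteGaloisGroup K)))
  (PG : ∀ k : ℕ, ContPairing (coeffRepK S θ' P k).toTopRep (torsRep M hstabK p k).toTopRep (mu K (p ^ k)).toTopRep)
  (w : HeightOneSpectrum (𝓞 K))

/-- **The canonical Shapiro isomorphism inverts the representative-based Shapiro lift** on `H¹(U_n, M[p^k])`: `sh (Sh ℓ) = ℓ` (the `torsRep` twin of T1-a's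
`shapiroCoindFinAddEquiv_shapiroLift`). [cite: NeukirchSchmidtWingberg2008, I §6 Prop. (1.6.4)] -/
theorem shapiroCoindFinAddEquiv_shapiroLift_torsRep (n k : ℕ) (ℓ : continuousCohomology 1 (subgroupRep (torsRep M hstabK p k).toTopRep (κ.layerSubgroup n))) :
    (torsRep M hstabK p k).shapiroCoindFinAddEquiv (κ.layerSubgroup n) (κ.isOpen_layerSubgroup n) 1
        (shapiroLift (torsRep M hstabK p k).toTopRep (κ.layerSubgroup n) (κ.isOpen_layerSubgroup n) (layerReps_spec κ n) (layerReps_one κ n) ℓ) = ℓ := by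
  obtain ⟨f, rfl⟩ := oneCocycleClass_surjective _ ℓ
  rw [shapiroLift_oneCocycleClass, ContinuousRep.shapiroCoindFinAddEquiv_apply, map_oneCocycleClass]
  have h : contOneCocycles.pullback (Literature.NumberTheory.GaloisRepresentations.subgroupIncl (κ.layerSubgroup n)) (coindFinEvalAtOne (torsRep M hstabK p k).toTopRep (κ.layerSubgroup n))
      (shapiroCocycle (torsRep M hstabK p k).toTopRep (κ.layerSubgroup n) (κ.isOpen_layerSubgroup n) (layerReps_spec κ n) f) =
      evalOne (torsRep M hstabK p k).toTopRep (κ.layerSubgroup n) (shapiroCocycle (torsRep M hstabK p k).toTopRep (κ.layerSubgroup n) (κ.isOpen_layerSubgroup n) (layerReps_spec κ n) f) :=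
    Subtype.ext (ContinuousMap.ext fun _ ↦ rfl)
  rw [h, evalOne_shapiroCocycle _ _ _ (layerReps_spec κ n) (layerReps_one κ n)]

/-- **The Mackey localisation of a torsion-level class IS g22's `locH1Layer`** for the canonical local action at `w` (pin `rfl`; definitional). [folklore] -/
theorem map_comapSubtypeHom_eq_locH1Layer (n k : ℕ) (ℓ : subgroupH1 (κ.layerSubgroup n) ↥(torsionPow M p k)) :
    letI := localAction (closureEmb (K := K) (w.adicCompletion K)) M
    (ContinuousCohomology.map (comapSubtypeHom (κ.layerSubgroup n) (resGalOfEmb (closureEmb (K := K) (w.adicCompletion K))))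
        (comapCoeffHom (torsRep M hstabK p k).toTopRep (κ.layerSubgroup n) (resGalOfEmb (closureEmb (K := K) (w.adicCompletion K)))) 1).hom ℓ =
      locH1Layer κ ↥(torsionPow M p k) w (fun _ _ ↦ rfl) n ℓ :=
  rfl

/-- **`semilocDual` through honda's restriction**: `semilocDual ℓ = H¹(Ψ|_w)(res_w (Sh_{U_n} ℓ))` (naturality of `res_w` in the duality morphism `Ψ`; definitional dialect bridge
`localization = ContinuousCohomology.map res_w (𝟙 _)`). [cite: NeukirchSchmidtWingberg2008, (8.6.2)] -/
theorem semilocDual_eq_cohomologyMap_map (n k : ℕ) (ℓ : continuousCohomology 1 (subgroupRep (torsRep M hstabK p k).toTopRep (κ.layerSubgroup n))) :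
    letI := layerQuotFintype κ n
    haveI := finite_oMuCarrier (K := K) S k
    semilocDual S κ θ' P M hstabK PG w n k ℓ =
      cohomologyMap ((TopRep.resFunctor (resGalOfEmb (closureEmb (K := K) (w.adicCompletion K)) : absoluteGaloisGroup (w.adicCompletion K) →* absoluteGaloisGroup K)).map
          (coindTateDualMor (coeffRepK S θ' P k) (torsRep M hstabK p k) (κ.layerSubgroup n) (pairingB S θ' P M hstabK PG k)
            (κ.isOpen_layerSubgroup n) (pairingB_smul S θ' P M hstabK PG k))) 1
        ((ContinuousCohomology.map (resGalOfEmb (closureEmb (K := K) (w.adicCompletion K)))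
          (𝟙 (TopRep.res (resGalOfEmb (closureEmb (K := K) (w.adicCompletion K)) : absoluteGaloisGroup (w.adicCompletion K) →* absoluteGaloisGroup K)
            (coindFin.{0, 0} (torsRep M hstabK p k).toTopRep (κ.layerSubgroup n)))) 1).hom
          (shapiroLift (torsRep M hstabK p k).toTopRep (κ.layerSubgroup n) (κ.isOpen_layerSubgroup n) (layerReps_spec κ n) (layerReps_one κ n) ℓ)) := by
  letI := layerQuotFintype κ n
  haveI := finite_oMuCarrier (K := K) S k
  change (ContinuousCohomology.map (resGalOfEmb (closureEmb (K := K) (w.adicCompletion K))) (𝟙 _) 1).hom _ = _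
  rw [map_cohomologyMap_eq_map, Category.comp_id, cohomologyMap_map_id_eq_map]

/-- ★★ **MACKEY VANISHING OF THE SEMILOCAL DUAL CLASS.** For the canonical local action at `w`: if for every `δ ∈ Γ_K` the conjugate `conj_δ ℓ` of the torsion-level layer class
`ℓ ∈ H¹(U_n, M[p^k])` is locally trivial at `w` (`loc_{n,w}(conj_δ ℓ) = 0` in `H¹(U_{n,w}, M[p^k])` — the localisations at ALL places of `K_n` above `w`), then `semilocDual … w n k ℓ = 0`
(tree `map_restrict_eq_zero_iff_forall_conjMap_one` applied to `Sh_{U_n} ℓ`, `sh (Sh ℓ) = ℓ`, `conjMap = conjH1`, then `H¹(Ψ|_w)` of zero). [cite: NeukirchSchmidtWingberg2008, I §5 (1.5.6)–(1.5.7), I §6 (1.6.4)–(1.6.5)]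
[cite: SerreLocalFields1979, VII §5] -/
theorem semilocDual_eq_zero_of_forall_locH1Layer_conjH1_eq_zero (n k : ℕ) (ℓ : subgroupH1 (κ.layerSubgroup n) ↥(torsionPow M p k))
    (h : letI := localAction (closureEmb (K := K) (w.adicCompletion K)) M
      ∀ δ : absoluteGaloisGroup K, locH1Layer κ ↥(torsionPow M p k) w (fun _ _ ↦ rfl) n (conjH1 (κ.layerSubgroup n) ↥(torsionPow M p k) δ ℓ) = 0) :
    semilocDual S κ θ' P M hstabK PG w n k ℓ = 0 := by
  haveI : CompactSpace (absoluteGaloisGroup K) := absoluteGaloisGroup_compactSpace K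
  haveI : CompactSpace (absoluteGaloisGroup (w.adicCompletion K)) := absoluteGaloisGroup_compactSpace _
  have hSh : (ContinuousCohomology.map (resGalOfEmb (closureEmb (K := K) (w.adicCompletion K)))
      (𝟙 (TopRep.res (resGalOfEmb (closureEmb (K := K) (w.adicCompletion K)) : absoluteGaloisGroup (w.adicCompletion K) →* absoluteGaloisGroup K)
        (coindFin.{0, 0} (torsRep M hstabK p k).toTopRep (κ.layerSubgroup n)))) 1).hom
      (shapiroLift (torsRep M hstabK p k).toTopRep (κ.layerSubgroup n) (κ.isOpen_layerSubgroup n) (layerReps_spec κ n) (layerReps_one κ n) ℓ) = 0 := by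
    rw [map_restrict_eq_zero_iff_forall_conjMap_one (torsRep M hstabK p k) (κ.layerSubgroup n) (κ.isOpen_layerSubgroup n)]
    intro δ
    rw [shapiroCoindFinAddEquiv_shapiroLift_torsRep, conjMap_torsRep_eq_conjH1]
    exact h δ
  rw [semilocDual_eq_cohomologyMap_map, hSh, map_zero]
  rfl

/-- ★ Hence the `ℚ/ℤ`-valued semilocal level pairing against `ℓ` vanishes for every semilocal class `t`. [cite: MilneADT2006, Ch. I, Cor. 2.3] -/
theorem semilocPairNKQ_eq_zero_of_forall_locH1Layer_conjH1_eq_zero (n k : ℕ) (t : semilocCoh S κ θ' P w n k 1) (ℓ : subgroupH1 (κ.layerSubgroup n) ↥(torsionPow M p k))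
    (h : letI := localAction (closureEmb (K := K) (w.adicCompletion K)) M
      ∀ δ : absoluteGaloisGroup K, locH1Layer κ ↥(torsionPow M p k) w (fun _ _ ↦ rfl) n (conjH1 (κ.layerSubgroup n) ↥(torsionPow M p k) δ ℓ) = 0) :
    semilocPairNKQ S κ θ' P M hstabK PG w n k t ℓ = 0 := by
  rw [semilocPairNKQ_apply]
  have h0 : semilocPairNK S κ θ' P M hstabK PG w n k t ℓ = 0 := by
    simp only [semilocPairNK]
    rw [semilocDual_eq_zero_of_forall_locH1Layer_conjH1_eq_zero S κ θ' P M hstabK PG w n k ℓ h, map_zero]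
  rw [h0, map_zero]

end Mackey

end Summit.BirchSwinnertonDyer.BirchSwinnertonDyer.Theorems.SmallImageRttD2Seq

end
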